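import Literature.AlgebraicGeometry.Motives.EllAdicBockstein
import Literature.AlgebraicGeometry.Motives.EllAdicTowerAlgebra
import Literature.AlgebraicGeometry.Motives.EtaleGaloisAction
import HarnessLib

/-!
# The pull-back and the Galois action on `ℓ`-adic étale cohomology `lim_m Hⁱ(–_ét, ℤ/ℓᵐ)`

`EllAdicComparison.lean` defines `Hⁱ(Y_ét, ℤ/ℓᵐ)` (`etaleCohomologyZModPow`), the reductions
`Hⁱ(Y_ét, ℤ/ℓᵐ⁺¹) → Hⁱ(Y_ét, ℤ/ℓᵐ)` (`etaleCohomologyZModPowMap`) and the inverse limit of a tower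
(`towerLim`, a subgroup of `∏_m`); `EllAdicTowerAlgebra.lean` puts the canonical `ℤ_ℓ`-module
structure on `towerLim` for `ℓ`-power-torsion towers (Milne V §1: "`Hʳ(X_et, ℤ_l) = lim Hʳ(X, ℤ/lⁿ)`
… the ring `ℤ_l = lim ℤ/(lⁿ)` acts"); `EtalePullback(Comp).lean` gives the functorial pull-back
`etaleCohomologyMap f M i : Hⁱ(Y_ét, M) → Hⁱ(X_ét, M)` and `EtaleGaloisAction.lean` the Galois
action on `Hⁱ((X_{k̄})_ét, M)`. This file passes to the limit:

* `towerLim.map` — **functoriality of `lim` in the tower** (a family `φ_m : A_m → B_m` commuting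
  with the transitions induces `lim φ`), with `map_id`, `map_comp`, `map_congr`, and its
  `ℤ_ℓ`-linearity `towerLim.mapLinear` for `ℓ`-power-torsion towers;
* `etaleCohomologyZModPowPullback f ℓ i m = f^* : Hⁱ(Y_ét, ℤ/ℓᵐ) → Hⁱ(X_ét, ℤ/ℓᵐ)` is a morphism of
  towers (`etaleCohomologyZModPowMap_pullback`, from the naturality of `f^*` in the coefficients),
  hence **`ellAdicEtaleCohomologyPullback f ℓ i : lim_m Hⁱ(Y_ét, ℤ/ℓᵐ) → lim_m Hⁱ(X_ét, ℤ/ℓᵐ)`**,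
  functorial (`_comp`, `_id`);
* **`geometricEllAdicEtaleCohomologyRep X ℓ i : Gal(k̄/k) →* End(lim_m Hⁱ((X_{k̄})_ét, ℤ/ℓᵐ))`**, the
  `ℓ`-adic Galois representation of a `k`-scheme on `Hⁱ((X_{k̄})_ét, ℤ_ℓ) := lim_m Hⁱ((X_{k̄})_ét, ℤ/ℓᵐ)`
  (Deligne, Weil I (1.15): "`Gal(F̄/F_q)` agit sur `Hⁱ(X, ℚ_ℓ)` (action par transport de
  structure)"), `ℤ_ℓ`-linear (`geometricEllAdicEtaleCohomologyRep_smul`) and given levelwise by the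
  representations of `EtaleGaloisAction.lean` (`coe_geometricEllAdicEtaleCohomologyRep_apply`).

## References

* J. S. Milne, *Étale cohomology* (reissue 2025), V §1 p. 176 (`ℓ`-adic cohomology as a limit,
  the `ℤ_l`-action), III Rem. 1.6 (c) (functoriality). [Milne2025]
* P. Deligne, *La conjecture de Weil. I*, Publ. Math. IHÉS 43 (1974), (1.15) p. 279. [Deligne1974]

## Design notes

* Everything is on the *étale* side `lim_m Hⁱ(Y_ét, ℤ/ℓᵐ)`; the identification with Mathlib's
  pro-étale `Scheme.EllAdicCohomology` is the business of `EllAdicComparison*.lean`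
  (Bhatt–Scholze 5.6.2 with `lim¹ = 0`), and `⊗ ℚ_ℓ` is not taken here.
* The torsion `Fact` required by `towerLim.instModulePadicInt` is registered as an instance for
  the étale towers (`fact_pow_smul_etaleCohomologyZModPow`, from `pow_smul_etaleCohomologyZModPow`).
-/

universe v u

open CategoryTheory CategoryTheory.Limits AlgebraicGeometry Opposite

namespace Literature.AlgebraicGeometry.Motives

/-! ### Maps of towers and the induced maps on `lim` -/

section TowerMap

variable {A B C : ℕ → Type v} [∀ m, AddCommGroup (A m)] [∀ m, AddCommGroup (B m)]
  [∀ m, AddCommGroup (C m)] {f : ∀ m, A (m + 1) →+ A m} {g : ∀ m, B (m + 1) →+ B m}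
  {h : ∀ m, C (m + 1) →+ C m}

/-- A **morphism of towers** `(φ_m : A_m → B_m)_m` commuting with the transition maps induces
`lim φ : lim_m A_m → lim_m B_m`, `(a_m)_m ↦ (φ_m a_m)_m` (functoriality of the inverse limit).
[folklore] -/
def towerLim.map (φ : ∀ m, A m →+ B m) (hφ : ∀ m (a : A (m + 1)), φ m (f m a) = g m (φ (m + 1) a)) :
    towerLim f →+ towerLim g where
  toFun a := ⟨fun m => φ m (a.1 m), by
    rw [mem_towerLim_iff]
    intro m
    rw [← hφ, (mem_towerLim_iff f).1 a.2 m]⟩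
  map_zero' := by ext m; simp
  map_add' a b := by ext m; simp

/-- Components of `lim φ`: `(lim φ (a))_m = φ_m (a_m)`. [folklore] -/
@[simp]
theorem towerLim.coe_map_apply (φ : ∀ m, A m →+ B m)
    (hφ : ∀ m (a : A (m + 1)), φ m (f m a) = g m (φ (m + 1) a)) (a : towerLim f) (m : ℕ) :
    (towerLim.map φ hφ a : ∀ m, B m) m = φ m (a.1 m) :=
  rfl

/-- `lim (id) = id`. [folklore] -/
theorem towerLim.map_id (a : towerLim f) :
    towerLim.map (g := f) (fun m => AddMonoidHom.id (A m)) (fun _ _ => rfl) a = a := by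
  ext m; rfl

/-- `lim (ψ ∘ φ) = lim ψ ∘ lim φ`. [folklore] -/
theorem towerLim.map_comp (φ : ∀ m, A m →+ B m)
    (hφ : ∀ m (a : A (m + 1)), φ m (f m a) = g m (φ (m + 1) a)) (ψ : ∀ m, B m →+ C m)
    (hψ : ∀ m (b : B (m + 1)), ψ m (g m b) = h m (ψ (m + 1) b))
    (hψφ : ∀ m (a : A (m + 1)), (ψ m).comp (φ m) (f m a) = h m ((ψ (m + 1)).comp (φ (m + 1)) a))
    (a : towerLim f) :
    towerLim.map (fun m => (ψ m).comp (φ m)) hψφ a = towerLim.map ψ hψ (towerLim.map φ hφ a) := by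
  ext m; rfl

/-- `lim φ` only depends on the maps `φ_m` (proof-irrelevance helper for rewriting the family).
[folklore] -/
theorem towerLim.map_congr {φ φ' : ∀ m, A m →+ B m}
    (hφ : ∀ m (a : A (m + 1)), φ m (f m a) = g m (φ (m + 1) a))
    (hφ' : ∀ m (a : A (m + 1)), φ' m (f m a) = g m (φ' (m + 1) a)) (e : ∀ m a, φ m a = φ' m a)
    (a : towerLim f) : towerLim.map φ hφ a = towerLim.map φ' hφ' a := by
  ext m; exact e m _

end TowerMap

/-! ### The pull-back on `Hⁱ(–_ét, ℤ/ℓᵐ)` and on `lim_m Hⁱ(–_ét, ℤ/ℓᵐ)` -/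

section Etale

variable {X Y : Scheme.{u}} (f : X ⟶ Y) (ℓ : ℕ)

/-- **The pull-back `f^* : Hⁱ(Y_ét, ℤ/ℓᵐ) → Hⁱ(X_ét, ℤ/ℓᵐ)`** (`etaleCohomologyMap` of
`EtalePullback.lean` for the coefficients `ℤ/ℓᵐ` of `EllAdicComparison.lean`).
[cite: Milne2025, III Remark 1.6 (c)] -/
noncomputable abbrev etaleCohomologyZModPowPullback (i m : ℕ) :
    etaleCohomologyZModPow Y ℓ i m →+ etaleCohomologyZModPow X ℓ i m :=
  etaleCohomologyMap f (zmodPowAb.{u} ℓ m) i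

/-- The pull-backs commute with the reductions `Hⁱ(–, ℤ/ℓᵐ⁺¹) → Hⁱ(–, ℤ/ℓᵐ)`: `(f^*)_m` is a
morphism of towers (naturality of `f^*` in the coefficients). [folklore] -/
theorem etaleCohomologyZModPowMap_pullback (i m : ℕ) (x : etaleCohomologyZModPow Y ℓ i (m + 1)) :
    etaleCohomologyZModPowPullback f ℓ i m (etaleCohomologyZModPowMap Y ℓ i m x) =
      etaleCohomologyZModPowMap X ℓ i m (etaleCohomologyZModPowPullback f ℓ i (m + 1) x) :=
  etaleCohomologyMap_map f (zmodPowAbRed.{u} ℓ m) i x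

/-- **The pull-back `f^* : lim_m Hⁱ(Y_ét, ℤ/ℓᵐ) → lim_m Hⁱ(X_ét, ℤ/ℓᵐ)`** on `ℓ`-adic étale
cohomology `Hⁱ(–_ét, ℤ_ℓ) := lim_m Hⁱ(–_ét, ℤ/ℓᵐ)` (Milne V §1 (c): "`Hʳ(X_et, ℤ_l) = lim Hʳ(X_et, ℤ/lⁿ)`",
functorial as a limit of functors). [cite: Milne2025, III Remark 1.6 (c)] -/
noncomputable def ellAdicEtaleCohomologyPullback (i : ℕ) :
    towerLim (etaleCohomologyZModPowMap Y ℓ i) →+ towerLim (etaleCohomologyZModPowMap X ℓ i) :=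
  towerLim.map (fun m => etaleCohomologyZModPowPullback f ℓ i m)
    (fun m x => etaleCohomologyZModPowMap_pullback f ℓ i m x)

/-- Components: `(f^* a)_m = f^*(a_m)`. [folklore] -/
@[simp]
theorem coe_ellAdicEtaleCohomologyPullback_apply (i : ℕ)
    (a : towerLim (etaleCohomologyZModPowMap Y ℓ i)) (m : ℕ) :
    (ellAdicEtaleCohomologyPullback f ℓ i a : ∀ m, etaleCohomologyZModPow X ℓ i m) m =
      etaleCohomologyZModPowPullback f ℓ i m (a.1 m) :=
  rfl

/-- **Transitivity** `(g f)^* = f^* ∘ g^*` on `lim_m Hⁱ(–_ét, ℤ/ℓᵐ)` (componentwise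
`etaleCohomologyMap_comp`). [cite: Milne2025, III Remark 1.6 (c)] -/
theorem ellAdicEtaleCohomologyPullback_comp {Z : Scheme.{u}} (g : Y ⟶ Z) (i : ℕ)
    (a : towerLim (etaleCohomologyZModPowMap Z ℓ i)) :
    ellAdicEtaleCohomologyPullback (f ≫ g) ℓ i a =
      ellAdicEtaleCohomologyPullback f ℓ i (ellAdicEtaleCohomologyPullback g ℓ i a) :=
  Subtype.ext <| funext fun m => etaleCohomologyMap_comp f g (zmodPowAb.{u} ℓ m) i (a.1 m)

/-- **Identity** `(𝟙)^* = id` on `lim_m Hⁱ(–_ét, ℤ/ℓᵐ)` (componentwise `etaleCohomologyMap_id`).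
[cite: Milne2025, III Remark 1.6 (c)] -/
theorem ellAdicEtaleCohomologyPullback_id (i : ℕ) (a : towerLim (etaleCohomologyZModPowMap X ℓ i)) :
    ellAdicEtaleCohomologyPullback (𝟙 X) ℓ i a = a :=
  Subtype.ext <| funext fun m => etaleCohomologyMap_id X (zmodPowAb.{u} ℓ m) i (a.1 m)

end Etale

/-! ### `ℤ_ℓ`-linearity of maps of `ℓ`-power-torsion towers -/

section Linear

variable (ℓ : ℕ) [Fact ℓ.Prime] {A B : ℕ → Type v} [∀ m, AddCommGroup (A m)]
  [∀ m, AddCommGroup (B m)] {f : ∀ m, A (m + 1) →+ A m} {g : ∀ m, B (m + 1) →+ B m}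
  [Fact (∀ n (a : A n), ℓ ^ n • a = 0)] [Fact (∀ n (b : B n), ℓ ^ n • b = 0)]

/-- A morphism of `ℓ`-power-torsion towers induces a **`ℤ_ℓ`-linear** map on `lim` for the
canonical `ℤ_ℓ`-module structures `(x • a)_n = (x mod ℓⁿ) • a_n` (`towerLim.instModulePadicInt`):
each `φ_n` commutes with `(x mod ℓⁿ) •`. [folklore] -/
def towerLim.mapLinear (φ : ∀ m, A m →+ B m)
    (hφ : ∀ m (a : A (m + 1)), φ m (f m a) = g m (φ (m + 1) a)) :
    towerLim f →ₗ[ℤ_[ℓ]] towerLim g where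
  __ := towerLim.map φ hφ
  map_smul' x a := Subtype.ext <| funext fun n => by
    change φ n (((x • a : towerLim f) : ∀ n, A n) n) =
      ((x • towerLim.map φ hφ a : towerLim g) : ∀ n, B n) n
    rw [towerLim.coe_smul_apply, towerLim.coe_smul_apply, map_nsmul]
    rfl

/-- `towerLim.mapLinear` is `towerLim.map` as a function. [folklore] -/
@[simp]
theorem towerLim.mapLinear_apply (φ : ∀ m, A m →+ B m)
    (hφ : ∀ m (a : A (m + 1)), φ m (f m a) = g m (φ (m + 1) a)) (a : towerLim f) :
    towerLim.mapLinear ℓ φ hφ a = towerLim.map φ hφ a :=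
  rfl

end Linear

/-! ### The `ℓ`-adic Galois representation `lim_m Hⁱ((X_{k̄})_ét, ℤ/ℓᵐ)` -/

section Galois

variable {k : Type u} [Field k] (X : SchemeOver k) (ℓ : ℕ) (i : ℕ)

/-- **The `ℓ`-adic Galois representation on `Hⁱ((X_{k̄})_ét, ℤ_ℓ) := lim_m Hⁱ((X_{k̄})_ét, ℤ/ℓᵐ)`**:
`ρ(g) = (1 × Spec g)^*` on each level, compatible with the reductions (Deligne, Weil I (1.15):
"`Gal(F̄/F_q)` agit sur `Hⁱ(X, ℚ_ℓ)` (action par transport de structure)"; Milne V §1). A group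
homomorphism by `ellAdicEtaleCohomologyPullback_comp`/`_id`. [cite: Deligne1974, (1.15)] -/
noncomputable def geometricEllAdicEtaleCohomologyRep :
    Field.absoluteGaloisGroup k →*
      AddMonoid.End (towerLim (etaleCohomologyZModPowMap (geometricFibre k X) ℓ i)) where
  toFun g := ellAdicEtaleCohomologyPullback (geometricFibreMap X g) ℓ i
  map_one' := by
    ext a : 1
    change ellAdicEtaleCohomologyPullback (geometricFibreMap X 1) ℓ i a = a
    rw [geometricFibreMap_one]
    exact ellAdicEtaleCohomologyPullback_id ℓ i a
  map_mul' g h := by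
    ext a : 1
    change ellAdicEtaleCohomologyPullback (geometricFibreMap X (g * h)) ℓ i a =
      ellAdicEtaleCohomologyPullback (geometricFibreMap X g) ℓ i
        (ellAdicEtaleCohomologyPullback (geometricFibreMap X h) ℓ i a)
    rw [geometricFibreMap_mul]
    exact ellAdicEtaleCohomologyPullback_comp _ ℓ _ i a

/-- Components: `(ρ(g) a)_m = ρ_m(g)(a_m)`, where `ρ_m` is the representation on
`Hⁱ((X_{k̄})_ét, ℤ/ℓᵐ)` (`geometricEtaleCohomologyRep`). [folklore] -/
theorem coe_geometricEllAdicEtaleCohomologyRep_apply (g : Field.absoluteGaloisGroup k)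
    (a : towerLim (etaleCohomologyZModPowMap (geometricFibre k X) ℓ i)) (m : ℕ) :
    (geometricEllAdicEtaleCohomologyRep X ℓ i g a :
        ∀ m, etaleCohomologyZModPow (geometricFibre k X) ℓ i m) m =
      geometricEtaleCohomologyRep X (zmodPowAb.{u} ℓ m) i g (a.1 m) :=
  rfl

/-- `ρ(g)` is `ℤ_ℓ`-linear for the canonical `ℤ_ℓ`-module structure on
`lim_m Hⁱ((X_{k̄})_ét, ℤ/ℓᵐ)` (`towerLim.instModulePadicInt`, available since `ℓᵐ` kills
`Hⁱ(–, ℤ/ℓᵐ)`, `pow_smul_etaleCohomologyZModPow`). [folklore] -/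
theorem geometricEllAdicEtaleCohomologyRep_smul [Fact ℓ.Prime]
    [Fact (∀ m (a : etaleCohomologyZModPow (geometricFibre k X) ℓ i m), ℓ ^ m • a = 0)]
    (g : Field.absoluteGaloisGroup k) (x : ℤ_[ℓ])
    (a : towerLim (etaleCohomologyZModPowMap (geometricFibre k X) ℓ i)) :
    geometricEllAdicEtaleCohomologyRep X ℓ i g (x • a) =
      x • geometricEllAdicEtaleCohomologyRep X ℓ i g a :=
  (towerLim.mapLinear ℓ (fun m => etaleCohomologyZModPowPullback (geometricFibreMap X g) ℓ i m)
    (fun m y => etaleCohomologyZModPowMap_pullback (geometricFibreMap X g) ℓ i m y)).map_smul x a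

/-- The torsion `Fact` needed for the `ℤ_ℓ`-module structure on `lim_m Hⁱ(Y_ét, ℤ/ℓᵐ)` holds
for every scheme (`pow_smul_etaleCohomologyZModPow`); recorded as an instance. [folklore] -/
instance fact_pow_smul_etaleCohomologyZModPow (Y : Scheme.{u}) :
    Fact (∀ m (a : etaleCohomologyZModPow Y ℓ i m), ℓ ^ m • a = 0) :=
  ⟨pow_smul_etaleCohomologyZModPow Y ℓ i⟩

end Galois

end Literature.AlgebraicGeometry.Motives
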